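import Mathlib
import Summits.MatrixMultiplication.MatrixMultiplication.Theses.MatrixPointInterpolation
import Summits.MatrixMultiplication.MatrixMultiplication.Theorems.LongMasquerade.Negative.WindowedKaplanskyTwoLemmas

/-!
# `MatrixPointInterpolation.TightWindows` (stmt-MatrixMultiplication-18939) — Negative lane:
# the hypothesis `2 ≤ k` is NOT load-bearing

Mutation analysis of the crux (crux disprover, `Cruxes/TightWindows/Disproof.lean` §(a)): the body of
`TightWindows` also holds — vacuously — at the excluded point sizes `k = 0` and `k = 1`, so a proof
may ignore `hk : 2 ≤ k` (it is the OTHER hypotheses that carry the statement: GEN, MASQ and the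
threshold are load-bearing, `Negative/LoadBearingHypotheses.lean`).

* `k = 0` (`body_zero`): every family of `0 × 0` matrices satisfies every equation, so MASQ at
  `k = 0` says that EVERY linear combination of words of length `≤ 2d` vanishes at `A`; the empty word
  gives `1 = 0` in `M_n(ℂ)`, impossible for `n ≥ 1`.
* `k = 1` (`body_one`): `xy - yx` is an identity of `M₁(ℂ) = ℂ` of degree `2 ≤ 2d` (`d ≥ 1` is forced
  by generation once `n ≥ 2`), so MASQ gives `A₀A₁ = A₁A₀`, and two commuting matrices do not generate
  `M_n`, `n ≥ 2` (`LongMasqueradeNeg.false_of_commute`, in tree).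
-/

namespace Summit.MatrixMultiplication.MatrixMultiplication.Theorems

namespace TightWindowsNeg

/-- The body of `TightWindows` at point size `k = 0` holds (vacuously: threshold `n₁ = 1`). [folklore] -/
theorem body_zero (ε : ℝ) : ∃ n₁ : ℕ, ∀ (n d : ℕ) (A : Fin 2 → Matrix (Fin n) (Fin n) ℂ), n₁ ≤ n →
    Submodule.span ℂ {M : Matrix (Fin n) (Fin n) ℂ |
      ∃ w : List (Fin 2), w.length ≤ d ∧ (w.map A).prod = M} = ⊤ →
    (∀ (T : Finset (List (Fin 2))) (c : List (Fin 2) → ℂ), (∀ w ∈ T, w.length ≤ 2 * d) →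
      (∀ B : Fin 2 → Matrix (Fin 0) (Fin 0) ℂ, (∑ w ∈ T, c w • (w.map B).prod) = 0) →
      (∑ w ∈ T, c w • (w.map A).prod) = 0) →
    (Module.finrank ℂ (Submodule.span ℂ
      {f : (Fin 2 → Matrix (Fin 0) (Fin 0) ℂ) → Matrix (Fin 0) (Fin 0) ℂ |
        ∃ w : List (Fin 2), w.length ≤ 2 * d ∧ f = fun B => (w.map B).prod}) : ℝ) ≤
      (n : ℝ) ^ ((2 : ℝ) + ε) := by
  refine ⟨1, fun n d A hn _ hwin => ?_⟩
  exfalso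
  have h := hwin {[]} (fun _ => 1) (by simp) (fun B => Subsingleton.elim _ _)
  simp only [Finset.sum_singleton, List.map_nil, List.prod_nil, one_smul] at h
  have h00 := congr_fun (congr_fun h ⟨0, hn⟩) ⟨0, hn⟩
  simp at h00

/-- The body of `TightWindows` at point size `k = 1` holds (vacuously: threshold `n₁ = 2`): the
commutator is an identity of `M₁(ℂ)` inside the window, so the generators commute and cannot generate
`M_n`, `n ≥ 2`. [folklore] -/
theorem body_one (ε : ℝ) : ∃ n₁ : ℕ, ∀ (n d : ℕ) (A : Fin 2 → Matrix (Fin n) (Fin n) ℂ), n₁ ≤ n →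
    Submodule.span ℂ {M : Matrix (Fin n) (Fin n) ℂ |
      ∃ w : List (Fin 2), w.length ≤ d ∧ (w.map A).prod = M} = ⊤ →
    (∀ (T : Finset (List (Fin 2))) (c : List (Fin 2) → ℂ), (∀ w ∈ T, w.length ≤ 2 * d) →
      (∀ B : Fin 2 → Matrix (Fin 1) (Fin 1) ℂ, (∑ w ∈ T, c w • (w.map B).prod) = 0) →
      (∑ w ∈ T, c w • (w.map A).prod) = 0) →
    (Module.finrank ℂ (Submodule.span ℂ
      {f : (Fin 2 → Matrix (Fin 1) (Fin 1) ℂ) → Matrix (Fin 1) (Fin 1) ℂ |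
        ∃ w : List (Fin 2), w.length ≤ 2 * d ∧ f = fun B => (w.map B).prod}) : ℝ) ≤
      (n : ℝ) ^ ((2 : ℝ) + ε) := by
  refine ⟨2, fun n d A hn hspan hwin => ?_⟩
  exfalso
  -- generation forces `d ≥ 1`
  have hd : 1 ≤ d := by
    by_contra hd0
    have hd0' : d = 0 := by omega
    subst hd0'
    -- in degree 0 only the empty word: the span is the scalars, not all of `M_n`, `n ≥ 2`
    have hsub : {M : Matrix (Fin n) (Fin n) ℂ | ∃ w : List (Fin 2), w.length ≤ 0 ∧ (w.map A).prod = M}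
        ⊆ {(1 : Matrix (Fin n) (Fin n) ℂ)} := by
      rintro M ⟨w, hw, rfl⟩
      have : w = [] := List.eq_nil_of_length_eq_zero (by omega)
      subst this
      simp
    have hle : (⊤ : Submodule ℂ (Matrix (Fin n) (Fin n) ℂ)) ≤ Submodule.span ℂ {(1 : Matrix (Fin n) (Fin n) ℂ)} := by
      rw [← hspan]; exact Submodule.span_mono hsub
    have hmem : Matrix.single (⟨0, by omega⟩ : Fin n) (⟨1, by omega⟩ : Fin n) (1 : ℂ) ∈
        Submodule.span ℂ {(1 : Matrix (Fin n) (Fin n) ℂ)} := hle Submodule.mem_top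
    rw [Submodule.mem_span_singleton] at hmem
    obtain ⟨s, hs⟩ := hmem
    have h01 := congr_fun (congr_fun hs ⟨0, by omega⟩) ⟨1, by omega⟩
    have h00 := congr_fun (congr_fun hs ⟨0, by omega⟩) ⟨0, by omega⟩
    simp at h01 h00
  -- the commutator is an identity of `M₁(ℂ)` of degree `2 ≤ 2d`
  have hcomm : A 0 * A 1 = A 1 * A 0 := by
    classical
    have h := hwin ({[0, 1], [1, 0]} : Finset (List (Fin 2)))
      (fun w => if w = [0, 1] then 1 else -1) (by
        intro w hw
        simp only [Finset.mem_insert, Finset.mem_singleton] at hw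
        rcases hw with rfl | rfl <;> simp <;> omega) (by
        intro B
        rw [Finset.sum_pair (by decide)]
        simp only [if_true, List.map_cons, List.map_nil, List.prod_cons, List.prod_nil, mul_one,
          one_smul]
        rw [if_neg (by decide)]
        ext i j
        fin_cases i; fin_cases j
        simp [Matrix.mul_apply, mul_comm])
    rw [Finset.sum_pair (by decide)] at h
    simp only [if_true, List.map_cons, List.map_nil, List.prod_cons, List.prod_nil, mul_one,
      one_smul] at h
    rw [if_neg (by decide), neg_one_smul, ← sub_eq_add_neg, sub_eq_zero] at h
    exact h
  exact LongMasqueradeNeg.false_of_commute hn hspan hcomm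

end TightWindowsNeg

end Summit.MatrixMultiplication.MatrixMultiplication.Theorems
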